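import Literature.Topology.FourManifolds.ParallelizablePullback
import Mathlib.Analysis.Normed.Operator.Bilinear
import HarnessLib

/-!
# A hypersurface transverse to a vector field in a manifold framed along it is stably parallelizable
# (regular levels of functions on parallelizable manifolds are s-parallelizable)

Topic `Literature/Topology/FourManifolds` (barrier seat
`provefact-Literature.Barriers.SmoothPoincare4.Stab-ad8c696e34`, seat 1: the levels of a Morse
function on a parallelizable 5-dimensional cobordism are s-parallelizable, hence spin — Kirby,
*The Topology of 4-Manifolds*, LNM 1374 (1989), Ch. X, proof of Thm. 1, p. 55: *"`W` is spin and so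
`M_{1/2}` is spin"*; Gompf–Stipsicz 1999, proof of Thm. 9.2.13).  Everything is PROVED; no
definition, no named fact.

M. Kervaire, J. Milnor, *Groups of homotopy spheres I*, Ann. of Math. 77 (1963), §3, p. 508, after
the definition of s-parallelizable ("the Whitney sum of the tangent bundle with a trivial line
bundle is trivial"): the tangent bundle of an ambient manifold restricts to a hypersurface with
trivial normal line bundle as `TW|_V ≅ TV ⊕ ε¹` (Milnor–Stasheff, *Characteristic classes*
(1974), §2–§3: Whitney sums, restriction of the ambient tangent bundle to a submanifold splits
off the normal bundle, here a line bundle trivialised by a transverse field; Hirsch,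
*Differential Topology* (1976), Ch. 4 §1–§2 (pull-backs) and §5 (tubular neighbourhoods, normal
bundles)).  Hence a framing of `TW` along `V` yields a framing of `TV ⊕ ε¹`, i.e. `V` is
s-parallelizable.  In the tree's language of framings (`Literature.Topology.FourManifolds.Spin`:
`HasTangentFramingAlong`, `HasStableTangentFramingAlong`, `IsStablyParallelizable`):

* `isOpen_setOf_isInvertible'` — invertible continuous linear maps `E →L F` form an open set;
* `isStablyParallelizable_of_transverse_framing` — **the splitting `TV ⊕ ℝ ≅ ι*TW`**: let
  `ι : V → W` be `C¹` between manifolds modelled on finite-dimensional spaces `E`, `E'` with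
  `dim E + 1 = dim E'` (`V` without, `W` possibly with boundary or corners), with injective
  differential, lying in a level of a function `g` differentiable along `ι` (`g ∘ ι` constant),
  let `ξ` be a continuous vector field on `W` with `dg(ξ) ≠ 0` along `ι` (transversality), and let
  `TW` be framed along `ι`.  Then `V` is stably parallelizable: at `p` the isomorphism
  `Φ_p(u, r) = dι_p(u) + r ξ(ι p) : T_pV ⊕ ℝ → T_{ι p}W` is injective (`dg ∘ dι = 0`, `dg(ξ) ≠ 0`)
  hence bijective, and `p ↦ Φ_p⁻¹(tᵢ(p))` is a continuous frame of `TV ⊕ ℝ` — continuity being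
  checked in the trivialisations of `TV` and `TW`, where `Φ_p` reads
  `(u, r) ↦ A_p u + r w_p` with `A_p` the derivative of `ι` in charts (Mathlib's
  `inTangentCoordinates`, continuous by `ContMDiffAt.mfderiv_const`) and `w_p` the coordinate of
  `ξ(ι p)`, exactly as in `IsParallelizable.of_hasTangentFramingAlong_of_isInvertible_mfderiv`
  (`ParallelizablePullback.lean`, the equidimensional case);
* `isStablyParallelizable_of_transverse_framing_of_isParallelizable` — the same from a global
  framing of `TW` (`IsParallelizable I' W`).

Consumer: regular levels of Morse functions on parallelizable cobordisms (gradient-like `ξ`),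
`StableBarrierFour` via a parallelizable null-cobordism of the homotopy 4-sphere.

## References

* M. Kervaire, J. Milnor, *Groups of homotopy spheres I*, Ann. of Math. 77 (1963), §3 p. 508
  (s-parallelizable; Lemma 3.3–3.4). [KervaireMilnorAnnals1963]
* J. Milnor, J. Stasheff, *Characteristic classes*, Princeton UP 1974, §2–§3 (Whitney sums,
  restriction to submanifolds, normal bundles). [MilnorStasheff1974]
* M. W. Hirsch, *Differential Topology*, GTM 33 (1976), Ch. 4 §1 p. 88, §2. [Hirsch1976]
* R. C. Kirby, *The Topology of 4-Manifolds*, LNM 1374 (1989), Ch. X p. 55. [Kirby1989]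
-/

open scoped Manifold ContDiff Topology
open Set Function Bundle Filter Module

noncomputable section

namespace Literature.Topology.FourManifolds

section Invertible

variable {E F : Type*} [NormedAddCommGroup E] [NormedSpace ℝ E] [CompleteSpace E]
  [NormedAddCommGroup F] [NormedSpace ℝ F]

/-- The set of invertible continuous linear maps `E →L F` (`E` complete) is open (Mathlib's
`ContinuousLinearEquiv.isOpen`). [folklore] -/
theorem isOpen_setOf_isInvertible' : IsOpen {f : E →L[ℝ] F | f.IsInvertible} := by
  convert ContinuousLinearEquiv.isOpen (𝕜 := ℝ) (E := E) (F := F) using 1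
  ext f
  simp only [mem_setOf_eq, ContinuousLinearMap.IsInvertible, mem_range]

end Invertible

section Level

variable {E : Type*} [NormedAddCommGroup E] [NormedSpace ℝ E] [FiniteDimensional ℝ E]
  {H : Type*} [TopologicalSpace H] {I : ModelWithCorners ℝ E H}
  {E' : Type*} [NormedAddCommGroup E'] [NormedSpace ℝ E'] [FiniteDimensional ℝ E']
  {H' : Type*} [TopologicalSpace H'] {I' : ModelWithCorners ℝ E' H'}
  {V : Type*} [TopologicalSpace V] [ChartedSpace H V] [IsManifold I 1 V]
  {W : Type*} [TopologicalSpace W] [ChartedSpace H' W] [IsManifold I' 1 W]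

/-- **A level hypersurface transverse to a vector field, in a manifold framed along it, is stably
parallelizable** (`TV ⊕ ℝ ≅ ι*TW`; Kervaire–Milnor 1963, §3 p. 508; Milnor–Stasheff §3).  See the
module docstring for the statement and the proof. [cite: KervaireMilnorAnnals1963, §3 p. 508] [cite: MilnorStasheff1974, §2–§3] [cite: Hirsch1976, Ch. 4 §1–§2] -/
theorem isStablyParallelizable_of_transverse_framing (hdim : finrank ℝ E + 1 = finrank ℝ E')
    {ι : V → W} (hι : ContMDiff I I' 1 ι) (hinj : ∀ p, Injective (mfderiv I I' ι p))
    {g : W → ℝ} {b : ℝ} (hg : ∀ p, MDifferentiableAt I' 𝓘(ℝ, ℝ) g (ι p)) (hgι : ∀ p, g (ι p) = b)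
    {ξ : Π x : W, TangentSpace I' x}
    (hξc : Continuous fun x => (⟨x, ξ x⟩ : TangentBundle I' W))
    (hξ : ∀ p, mfderiv I' 𝓘(ℝ, ℝ) g (ι p) (ξ (ι p)) ≠ 0)
    (ht : HasTangentFramingAlong I' W ι) :
    IsStablyParallelizable I V := by
  classical
  haveI : CompleteSpace (E × ℝ) := FiniteDimensional.complete ℝ (E × ℝ)
  obtain ⟨t, htc, htli⟩ := ht
  -- the splitting maps `Φ_p (u, r) = dι_p u + r • ξ (ι p)`
  set Φ : V → (E × ℝ) →L[ℝ] E' := fun p =>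
    (show E →L[ℝ] E' from mfderiv I I' ι p).comp (ContinuousLinearMap.fst ℝ E ℝ) +
      ContinuousLinearMap.smulRightL ℝ (E × ℝ) E' (ContinuousLinearMap.snd ℝ E ℝ)
        (show E' from ξ (ι p)) with hΦdef
  have hΦapply : ∀ p (u : E) (r : ℝ), Φ p (u, r) = mfderiv I I' ι p u + r • ξ (ι p) := by
    intro p u r
    rfl
  -- `dg ∘ dι = 0` along the level
  have hker : ∀ p (u : E), mfderiv I' 𝓘(ℝ, ℝ) g (ι p) (mfderiv I I' ι p u) = 0 := by
    intro p u
    have hιd : MDifferentiableAt I I' ι p := hι.mdifferentiableAt one_ne_zero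
    have h1 : mfderiv I 𝓘(ℝ, ℝ) (g ∘ ι) p = (mfderiv I' 𝓘(ℝ, ℝ) g (ι p)).comp (mfderiv I I' ι p) :=
      mfderiv_comp p (hg p) hιd
    have h2 : mfderiv I 𝓘(ℝ, ℝ) (g ∘ ι) p = 0 := by
      rw [show g ∘ ι = fun _ => b from funext hgι, mfderiv_const]
    exact congrArg (fun L : E →L[ℝ] ℝ => L u) (h1.symm.trans h2)
  -- `Φ_p` is injective
  have hΦinj : ∀ p, Injective (Φ p) := by
    intro p q q' h
    obtain ⟨u, r⟩ := q
    obtain ⟨u', r'⟩ := q'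
    rw [hΦapply, hΦapply] at h
    have hL := congrArg (mfderiv I' 𝓘(ℝ, ℝ) g (ι p)) h
    simp only [map_add, map_smul, hker, zero_add] at hL
    have hr : r = r' := smul_left_injective ℝ (hξ p) hL
    subst hr
    have hu : mfderiv I I' ι p u = mfderiv I I' ι p u' := add_right_cancel h
    exact Prod.ext (hinj p hu) rfl
  -- hence invertible: the dimensions agree
  have hΦinv : ∀ p, (Φ p).IsInvertible := by
    intro p
    have hfr : finrank ℝ (E × ℝ) = finrank ℝ E' := by rw [finrank_prod, finrank_self, hdim]
    have hsurj : Surjective (Φ p) :=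
      (LinearMap.injective_iff_surjective_of_finrank_eq_finrank hfr).1 (hΦinj p)
    let e : (E × ℝ) ≃L[ℝ] E' :=
      (LinearEquiv.ofBijective (Φ p).toLinearMap ⟨hΦinj p, hsurj⟩).toContinuousLinearEquiv
    exact ⟨e, ContinuousLinearMap.ext fun x => rfl⟩
  -- the stable frame `s_j (p) = Φ_p⁻¹ (t_j p)`; continuity in the trivialisations at each `p₀`
  have key : ∀ (i : Fin (finrank ℝ E')) (p₀ : V), ContinuousAt (fun p =>
      ((trivializationAt E (TangentSpace I) p₀
          (⟨p, ((Φ p).inverse (t i p)).1⟩ : TangentBundle I V)).2, ((Φ p).inverse (t i p)).2)) p₀ := by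
    intro i p₀
    -- the derivative of `ι` in the charts at `p₀`, `ι p₀`
    set A : V → E →L[ℝ] E' := inTangentCoordinates I I' id ι (mfderiv I I' ι) p₀ with hA
    have hAc : ContinuousAt A p₀ :=
      ((hι p₀).mfderiv_const (m := 0) (by rw [zero_add])).continuousAt
    -- the coordinate of `ξ (ι p)` in the trivialisation of `TW` at `ι p₀`
    set w : V → E' := fun p => (trivializationAt E' (TangentSpace I') (ι p₀)
      (⟨ι p, ξ (ι p)⟩ : TangentBundle I' W)).2 with hw
    have hwc : ContinuousAt w p₀ := by
      have := (hξc.comp hι.continuous).continuousAt (x := p₀)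
      rw [FiberBundle.continuousAt_totalSpace] at this
      exact this.2
    -- the given frame read in the trivialisation of `TW` at `ι p₀`
    set σ : V → E' := fun p => (trivializationAt E' (TangentSpace I') (ι p₀)
      (⟨ι p, t i p⟩ : TangentBundle I' W)).2 with hσ
    have hσc : ContinuousAt σ p₀ := by
      have := (htc i).continuousAt (x := p₀)
      rw [FiberBundle.continuousAt_totalSpace] at this
      exact this.2
    -- `Φ` in coordinates
    set Ψ : V → (E × ℝ) →L[ℝ] E' := fun p =>
      (A p).comp (ContinuousLinearMap.fst ℝ E ℝ) +
        ContinuousLinearMap.smulRightL ℝ (E × ℝ) E' (ContinuousLinearMap.snd ℝ E ℝ) (w p) with hΨdef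
    have hΨapply : ∀ p (u : E) (r : ℝ), Ψ p (u, r) = A p u + r • w p := by
      intro p u r
      simp [hΨdef, ContinuousLinearMap.smulRightL_apply_apply]
    have hΨc : ContinuousAt Ψ p₀ := by
      refine (hAc.clm_comp continuousAt_const).add ?_
      exact (ContinuousLinearMap.smulRightL ℝ (E × ℝ) E'
        (ContinuousLinearMap.snd ℝ E ℝ)).continuous.continuousAt.comp hwc
    -- at `p₀` the coordinate changes are the identity: `Ψ p₀ = Φ p₀`
    have hA0 : A p₀ = mfderiv I I' ι p₀ := by
      rw [hA, inTangentCoordinates_eq _ _ _ (mem_chart_source H p₀) (mem_chart_source H' (ι p₀))]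
      ext v
      change tangentCoordChange I' (ι p₀) (ι p₀) (ι p₀)
        (mfderiv I I' ι p₀ (tangentCoordChange I p₀ p₀ p₀ v)) = _
      rw [tangentCoordChange_self (by simp), tangentCoordChange_self (by simp)]
      rfl
    have hw0 : w p₀ = ξ (ι p₀) := by
      rw [hw]
      change tangentCoordChange I' (ι p₀) (ι p₀) (ι p₀) (ξ (ι p₀)) = _
      rw [tangentCoordChange_self (by simp)]
    have hΨ0 : Ψ p₀ = Φ p₀ := by
      refine ContinuousLinearMap.ext fun q => ?_
      obtain ⟨u, r⟩ := q
      rw [hΨapply, hΦapply, hA0, hw0]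
      rfl
    have hΨinv : ∀ᶠ p in 𝓝 p₀, (Ψ p).IsInvertible :=
      hΨc.preimage_mem_nhds (isOpen_setOf_isInvertible'.mem_nhds
        (by rw [mem_setOf_eq, hΨ0]; exact hΦinv p₀))
    -- chart-domain conditions hold near `p₀`
    have h1 : ∀ᶠ p in 𝓝 p₀, p ∈ (chartAt H p₀).source :=
      (chartAt H p₀).open_source.mem_nhds (mem_chart_source H p₀)
    have h2 : ∀ᶠ p in 𝓝 p₀, ι p ∈ (chartAt H' (ι p₀)).source :=
      hι.continuous.continuousAt.preimage_mem_nhds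
        ((chartAt H' (ι p₀)).open_source.mem_nhds (mem_chart_source H' (ι p₀)))
    -- near `p₀`, `Ψ p` maps the new frame (read at `p₀`) to the given frame (read at `ι p₀`)
    have hid : ∀ᶠ p in 𝓝 p₀, Ψ p ((trivializationAt E (TangentSpace I) p₀
        (⟨p, ((Φ p).inverse (t i p)).1⟩ : TangentBundle I V)).2, ((Φ p).inverse (t i p)).2) = σ p := by
      filter_upwards [h1, h2] with p hp hp'
      have hp'' : p ∈ (extChartAt I p).source ∩ (extChartAt I p₀).source ∩ (extChartAt I p).source := by
        simp only [extChartAt_source, mem_inter_iff, mem_chart_source, hp, and_self]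
      -- the derivative in charts, applied to the coordinate of a tangent vector at `p`
      have hAp : ∀ v : E, A p (tangentCoordChange I p p₀ p v) =
          tangentCoordChange I' (ι p) (ι p₀) (ι p) (mfderiv I I' ι p v) := by
        intro v
        rw [hA, inTangentCoordinates_eq _ _ _ (show id p ∈ (chartAt H (id p₀)).source from hp) hp']
        change tangentCoordChange I' (ι p) (ι p₀) (ι p) (mfderiv I I' ι p
          (tangentCoordChange I p₀ p p (tangentCoordChange I p p₀ p v))) = _
        rw [tangentCoordChange_comp hp'', tangentCoordChange_self (by simp)]
      have hwp : w p = tangentCoordChange I' (ι p) (ι p₀) (ι p) (ξ (ι p)) := rfl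
      have hσp : σ p = tangentCoordChange I' (ι p) (ι p₀) (ι p) (t i p) := rfl
      have h5 : mfderiv I I' ι p ((Φ p).inverse (t i p)).1 + ((Φ p).inverse (t i p)).2 • ξ (ι p) =
          t i p := by
        have h6 := hΦapply p ((Φ p).inverse (t i p)).1 ((Φ p).inverse (t i p)).2
        rw [Prod.mk.eta, (hΦinv p).self_apply_inverse] at h6
        exact h6.symm
      rw [hΨapply, trivializationAt_snd_eq_tangentCoordChange, hAp, hwp, hσp]
      conv_rhs => rw [← h5]
      erw [map_add, map_smul]
    -- conclude: near `p₀` the frame reads `(Ψ p)⁻¹ (σ p)`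
    obtain ⟨e, he⟩ := (show (Ψ p₀).IsInvertible by rw [hΨ0]; exact hΦinv p₀)
    have hinvc : ContinuousAt (fun p => (Ψ p).inverse (σ p)) p₀ := by
      have h1 : ContinuousAt ContinuousLinearMap.inverse (Ψ p₀) := by
        rw [← he]
        exact (contDiffAt_map_inverse (n := 0) e).continuousAt
      exact (h1.comp hΨc).clm_apply hσc
    refine hinvc.congr ?_
    filter_upwards [hid, hΨinv] with p hp hpinv
    rw [← hp, hpinv.inverse_apply_self]
  refine ⟨fun j p => (Φ p).inverse (t (Fin.cast hdim j) p), fun j => ?_, fun j => ?_, fun p => ?_⟩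
  · -- continuity of the tangent components, checked in the trivialisation at each `p₀`
    rw [continuous_iff_continuousAt]
    intro p₀
    rw [show (fun p : V => (TotalSpace.mk' E (id p) ((Φ p).inverse (t (Fin.cast hdim j) p)).1 :
        TangentBundle I V)) = fun p : V => TotalSpace.mk' E p
          ((fun q : V => (((Φ q).inverse (t (Fin.cast hdim j) q)).1 : TangentSpace I q)) p) from rfl,
      FiberBundle.continuousAt_section]
    exact (key (Fin.cast hdim j) p₀).fst
  · -- continuity of the real components
    rw [continuous_iff_continuousAt]
    intro p₀
    exact (key (Fin.cast hdim j) p₀).snd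
  · -- pointwise linear independence: `Φ_p` maps the family to the frame `(tᵢ p)ᵢ`
    have hli : LinearIndependent ℝ fun i => (Φ p).inverse (t i p) := by
      refine LinearIndependent.of_comp (Φ p).toLinearMap ?_
      convert htli p using 1
      funext i
      exact (hΦinv p).self_apply_inverse (t i p)
    exact hli.comp (Fin.cast hdim) (Fin.cast_injective hdim)

/-- **Regular levels of functions on parallelizable manifolds are s-parallelizable** — the case of
a global framing of `TW` (`IsParallelizable I' W`), restricted along `ι`
(`HasTangentFramingAlong.comp`). [cite: KervaireMilnorAnnals1963, §3 p. 508] [cite: Kirby1989, Ch. X p. 55 ("W is spin and so M_{1/2} is spin")] -/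
theorem isStablyParallelizable_of_transverse_framing_of_isParallelizable
    (hdim : finrank ℝ E + 1 = finrank ℝ E') (hW : IsParallelizable I' W)
    {ι : V → W} (hι : ContMDiff I I' 1 ι) (hinj : ∀ p, Injective (mfderiv I I' ι p))
    {g : W → ℝ} {b : ℝ} (hg : ∀ p, MDifferentiableAt I' 𝓘(ℝ, ℝ) g (ι p)) (hgι : ∀ p, g (ι p) = b)
    {ξ : Π x : W, TangentSpace I' x}
    (hξc : Continuous fun x => (⟨x, ξ x⟩ : TangentBundle I' W))
    (hξ : ∀ p, mfderiv I' 𝓘(ℝ, ℝ) g (ι p) (ξ (ι p)) ≠ 0) :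
    IsStablyParallelizable I V :=
  isStablyParallelizable_of_transverse_framing hdim hι hinj hg hgι hξc hξ
    (HasTangentFramingAlong.comp hW ⟨ι, hι.continuous⟩)

end Level

end Literature.Topology.FourManifolds

end
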